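import Summits.KontsevichZagierPeriods.KontsevichZagierPeriods.Theorems.RootDecompZetaThreeFrontierCellZetaFourP03

/-! # `RootDecompZetaThreeFrontierCellZetaFourP04` — part 4/11 of the mechanical ≤400-line split of `cz_src_doc.lean` (sha256 4f990bc7d7dc4f98…)
Source: decomp-kz lens-1 g13 CellZetaNF_v2.lean @9c7c1e48 LEVEL 1 (§H1a chords/frames/NBCSpan, §H1b, §H4a, §H4b residues, §H5 certificate, §H8 rung 4 ⟸ (A₄); JOB C 98×98 certificate; critic CLEARED g6-20 l.1368); --supports stmt-KontsevichZagierPeriods-27141.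
Split by census-1 g10 `gen/splitlean.py`: scopes re-opened with their `open`/`variable`/`set_option` context; mathematics and declaration order unchanged. -/

set_option linter.dupNamespace false

namespace Summit.KontsevichZagierPeriods.KontsevichZagierPeriods.Cruxes.GZNormalFormWThree.GZLadder.CellZetaFour
open Set MeasureTheory Finset
open Literature.NumberTheory.Transcendental
open Summit.KontsevichZagierPeriods.KontsevichZagierPeriods.Cruxes.GZNormalFormWThree.GZLadder.RungFour
open Summit.KontsevichZagierPeriods.KontsevichZagierPeriods.Cruxes.GZNormalFormWThree.GZLadder.RotFour (mem_simplex_four_iff)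
set_option linter.unusedSimpArgs false
set_option linter.unusedVariables false
set_option linter.style.longLine false

/-- Auxiliary step `form_c01` (§H4): form c01. [bookkeeping] -/
@[simp] theorem form_c01 (t : Fin 4 → ℝ) : (c01).form t = (1 - t 0) := rfl
/-- Auxiliary step `form_c02` (§H4): form c02. [bookkeeping] -/
@[simp] theorem form_c02 (t : Fin 4 → ℝ) : (c02).form t = (1 - t 1) := rfl
/-- Auxiliary step `form_c03` (§H4): form c03. [bookkeeping] -/
@[simp] theorem form_c03 (t : Fin 4 → ℝ) : (c03).form t = (1 - t 2) := rfl
/-- Auxiliary step `form_c04` (§H4): form c04. [bookkeeping] -/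
@[simp] theorem form_c04 (t : Fin 4 → ℝ) : (c04).form t = (1 - t 3) := rfl
/-- Auxiliary step `form_c12` (§H4): form c12. [bookkeeping] -/
@[simp] theorem form_c12 (t : Fin 4 → ℝ) : (c12).form t = (t 0 - t 1) := rfl
/-- Auxiliary step `form_c13` (§H4): form c13. [bookkeeping] -/
@[simp] theorem form_c13 (t : Fin 4 → ℝ) : (c13).form t = (t 0 - t 2) := rfl
/-- Auxiliary step `form_c14` (§H4): form c14. [bookkeeping] -/
@[simp] theorem form_c14 (t : Fin 4 → ℝ) : (c14).form t = (t 0 - t 3) := rfl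
/-- Auxiliary step `form_c15` (§H4): form c15. [bookkeeping] -/
@[simp] theorem form_c15 (t : Fin 4 → ℝ) : (c15).form t = t 0 := by
  rw [show (c15).form t = t 0 - 0 from rfl, sub_zero]
/-- Auxiliary step `form_c23` (§H4): form c23. [bookkeeping] -/
@[simp] theorem form_c23 (t : Fin 4 → ℝ) : (c23).form t = (t 1 - t 2) := rfl
/-- Auxiliary step `form_c24` (§H4): form c24. [bookkeeping] -/
@[simp] theorem form_c24 (t : Fin 4 → ℝ) : (c24).form t = (t 1 - t 3) := rfl
/-- Auxiliary step `form_c25` (§H4): form c25. [bookkeeping] -/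
@[simp] theorem form_c25 (t : Fin 4 → ℝ) : (c25).form t = t 1 := by
  rw [show (c25).form t = t 1 - 0 from rfl, sub_zero]
/-- Auxiliary step `form_c34` (§H4): form c34. [bookkeeping] -/
@[simp] theorem form_c34 (t : Fin 4 → ℝ) : (c34).form t = (t 2 - t 3) := rfl
/-- Auxiliary step `form_c35` (§H4): form c35. [bookkeeping] -/
@[simp] theorem form_c35 (t : Fin 4 → ℝ) : (c35).form t = t 2 := by
  rw [show (c35).form t = t 2 - 0 from rfl, sub_zero]
/-- Auxiliary step `form_c45` (§H4): form c45. [bookkeeping] -/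
@[simp] theorem form_c45 (t : Fin 4 → ℝ) : (c45).form t = t 3 := by
  rw [show (c45).form t = t 3 - 0 from rfl, sub_zero]

end Summit.KontsevichZagierPeriods.KontsevichZagierPeriods.Cruxes.GZNormalFormWThree.GZLadder.CellZetaFour
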